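import Literature.Analysis.FluidPDE.ReleaseLogBoundPairT
import Literature.Analysis.FluidPDE.ReleaseLogBoundDatum
import Literature.Analysis.FluidPDE.SeisDissipationRateBoundProofs
import Literature.Analysis.FluidPDE.PassiveScalarEnergySlice
import HarnessLib

/-!
# The logarithmic dissipation bound for releases, smooth drifts: the core inequality

Analysis/FluidPDE proof-support file (everything proved). For a classical solution `θ` of
`∂ₜθ + u·∇θ = κΔθ`, `θ(0) = h`, on `[0,T] × T^d` with a smooth divergence-free drift `u`,
`κ = δ²`, `0 < δ ≤ 1/4`, a smooth datum with `|h| ≤ H`, `‖∇h‖ ≤ L`, and a strain budget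
`∫₀ᵀ ‖∇u‖_{L²} ≤ S`, the variance dissipated in the window obeys, for every scale `ℓ > 0`,

  `2κ ∫₀ᵀ ‖∇θ‖² ≤ ½ ( d L² ℓ² + (4H²/log(1 + 4ℓ²/δ²)) (log(1 + 4π²d) + 4π² d T + 2π (C_d d)^{1/2} S) )`

(`two_mul_scalarDissipation_le_core`). Proof (two-point / backward-characteristics form of the
Crippa–De Lellis logarithmic estimate): with the reversed kernel family `χ^w`
(`ReleaseKernelFamily`) and the periodic logarithmic cost `Φ_δ` (`PeriodicLogCost`),

* energy identity: `2κ∫‖∇θ‖² = ‖h‖² - ‖θ(T)‖²` (`PassiveScalarClassicalEnergy`);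
* Young: `‖θ(T)‖² ≥ ‖θ(T) ⋆ k_δ‖² = ∫ (∫ h χ^w(T))² dw` (duality, `ReleaseKernelMarginal`);
* variance identity and splitting at scale `ℓ` (`ReleaseLogBoundDatum`), Lebesgue marginals:
  `∫ (∫ h χ^w(T))² dw ≥ ‖h‖² - ½ (d L² ℓ² + (4H²/Λ_ℓ) Q(T))`;
* the separation functional `Q(T) ≤ log(1 + 4π²d) + 4π² d T + 2π (C_d d)^{1/2} S`
  (`ReleaseLogBoundPairT`).

## References

* G. Crippa, C. De Lellis, *Estimates and regularity results for the DiPerna–Lions flow*,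
  J. reine angew. Math. 616 (2008), Thm. 2.1 / §2.
* C. Seis, Comm. Math. Phys. 399 (2023) = arXiv:2003.08794, §2.2. [`Seis2022`]
* T. D. Drivas, G. L. Eyink, *A Lagrangian fluctuation–dissipation relation for scalar
  turbulence*, J. Fluid Mech. 829 (2017), §2 (dissipation as two-particle backward dispersion).
  [`DrivasEyink2017`]
-/

noncomputable section

open MeasureTheory Set Filter Topology Function Metric Real
open scoped InnerProductSpace ENNReal Convolution
open Literature.Analysis.FunctionSpaces Literature.Analysis.FunctionSpaces.Torus
open Literature.Analysis.SingularIntegrals Literature.Analysis.SingularIntegrals.Torus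

namespace Literature.Analysis.FluidPDE

namespace Torus

variable {d : Type*} [Fintype d] [DecidableEq d]

section Core

variable {κ T δ : ℝ} {u : ℝ → UnitAddTorus d → EuclideanSpace ℝ d} {θ : ℝ → UnitAddTorus d → ℝ}
  {h : UnitAddTorus d → ℝ}

/-- **The `w`-integrated variance bound of the reversed kernels against the datum**: with
`Q(T) = ∫ ∫∫ Φ_δ(x-y) χ^w(T,x)χ^w(T,y)`,
`‖h‖² - ½ (d L² ℓ² + (4H²/Λ_ℓ) Q(T)) ≤ ∫ (∫∫ h(x)h(y) χ^w(T,x)χ^w(T,y)) dw`. [folklore] -/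
theorem integral_sq_sub_le_integral_pair (hκ : 0 < κ) (hT : 0 < T)
    (hu : FunctionSpaces.Torus.IsSmoothSpaceTimeOn (Icc 0 T) u) (hdiv : ∀ t ∈ Icc 0 T, IsDivFree (u t))
    (hδ : 0 < δ) (hδ4 : δ ≤ 1 / 4) {χ : UnitAddTorus d → ℝ → UnitAddTorus d → ℝ}
    (hχ : ∀ w, IsClassicalScalarTransportOn (Icc 0 T) κ (fun τ x => -u (T - τ) x) (χ w))
    (hχ0 : ∀ w x, χ w 0 x = kernel δ (x - w)) (hh : IsSmooth h) {H L ℓ : ℝ}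
    (hH : ∀ x, |h x| ≤ H) (hL : ∀ x, ‖Torus.gradient h x‖ ≤ L) (hℓ : 0 < ℓ) :
    (∫ x, h x ^ 2) - (1 / 2) * (Fintype.card d * L ^ 2 * ℓ ^ 2 +
        4 * H ^ 2 / Real.log (1 + 4 * ℓ ^ 2 / δ ^ 2) *
          ∫ w, ∫ x, ∫ y, sinLogCost δ (x - y) * (χ w T x * χ w T y)) ≤
      ∫ w, ∫ x, ∫ y, h x * h y * (χ w T x * χ w T y) := by
  have hTI : T ∈ Icc 0 T := right_mem_Icc.2 hT.le
  have hhc : Continuous h := hh.continuous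
  set Λ : ℝ := Real.log (1 + 4 * ℓ ^ 2 / δ ^ 2) with hΛ
  set A : ℝ := Fintype.card d * L ^ 2 * ℓ ^ 2 with hA
  have hB0 : 0 ≤ 4 * H ^ 2 / Λ := by
    have : 0 < Λ := Real.log_pos (lt_add_of_pos_right 1 (by positivity))
    positivity
  have hf0 : ∀ w x, 0 ≤ χ w T x := fun w x => reversedKernel_nonneg hκ.le hδ.le hχ hχ0 w hTI x
  have hf1 : ∀ w, ∫ x, χ w T x = 1 := fun w => integral_reversedKernel_eq_one hδ hδ4 hχ hχ0 w hTI
  have hfc : ∀ w, Continuous (χ w T) := fun w => ((hχ w).smooth_scalar.isSmooth_slice hTI).continuous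
  have hφc : Continuous (sinLogCost δ : UnitAddTorus d → ℝ) := continuous_sinLogCost δ
  -- per `w`: variance identity and splitting
  have hper : ∀ w, (∫ x, h x ^ 2 * χ w T x) - (1 / 2) * (A + 4 * H ^ 2 / Λ *
      ∫ x, ∫ y, sinLogCost δ (x - y) * (χ w T x * χ w T y)) ≤
      ∫ x, ∫ y, h x * h y * (χ w T x * χ w T y) := by
    intro w
    rw [integral_integral_mul_mul_eq hhc (hfc w) (hf1 w)]
    have hcost : ∫ x, ∫ y, (h x - h y) ^ 2 * (χ w T x * χ w T y) ≤
        A + 4 * H ^ 2 / Λ * ∫ x, ∫ y, sinLogCost δ (x - y) * (χ w T x * χ w T y) := by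
      have hpt : ∀ x y, (h x - h y) ^ 2 * (χ w T x * χ w T y) ≤
          (A + 4 * H ^ 2 / Λ * sinLogCost δ (x - y)) * (χ w T x * χ w T y) := fun x y =>
        mul_le_mul_of_nonneg_right (sq_sub_le_sinLogCost hh hH hL hℓ hδ.ne' x y) (mul_nonneg (hf0 w x) (hf0 w y))
      have hin : ∀ x, ∫ y, (h x - h y) ^ 2 * (χ w T x * χ w T y) ≤
          A * χ w T x + 4 * H ^ 2 / Λ * ∫ y, sinLogCost δ (x - y) * (χ w T x * χ w T y) := by
        intro x
        have i1 : Integrable (fun y => (h x - h y) ^ 2 * (χ w T x * χ w T y)) volume :=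
          (((continuous_const.sub hhc).pow 2).mul (continuous_const.mul (hfc w))).integrable_unitAddTorus
        have i2 : Integrable (fun y => (A + 4 * H ^ 2 / Λ * sinLogCost δ (x - y)) * (χ w T x * χ w T y)) volume :=
          ((continuous_const.add (continuous_const.mul (hφc.comp (continuous_const.sub continuous_id)))).mul
            (continuous_const.mul (hfc w))).integrable_unitAddTorus
        refine (integral_mono i1 i2 (hpt x)).trans (le_of_eq ?_)
        have e : (fun y => (A + 4 * H ^ 2 / Λ * sinLogCost δ (x - y)) * (χ w T x * χ w T y)) =
            fun y => (A * χ w T x) * χ w T y + (4 * H ^ 2 / Λ) * (sinLogCost δ (x - y) * (χ w T x * χ w T y)) := by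
          funext y; ring
        have i3 : Integrable (fun y => A * χ w T x * χ w T y) volume := (hfc w).integrable_unitAddTorus.const_mul _
        have i4 : Integrable (fun y => (4 * H ^ 2 / Λ) * (sinLogCost δ (x - y) * (χ w T x * χ w T y))) volume :=
          (((hφc.comp (continuous_const.sub continuous_id)).mul (continuous_const.mul (hfc w))).integrable_unitAddTorus).const_mul _
        rw [e, integral_add i3 i4, integral_const_mul, integral_const_mul, hf1, mul_one]
      have hc1 : Continuous (uncurry fun x y : UnitAddTorus d => (h x - h y) ^ 2 * (χ w T x * χ w T y)) :=
        (((hhc.comp continuous_fst).sub (hhc.comp continuous_snd)).pow 2).mul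
          (((hfc w).comp continuous_fst).mul ((hfc w).comp continuous_snd))
      have hc2 : Continuous (uncurry fun x y : UnitAddTorus d => sinLogCost δ (x - y) * (χ w T x * χ w T y)) :=
        (hφc.comp (continuous_fst.sub continuous_snd)).mul (((hfc w).comp continuous_fst).mul ((hfc w).comp continuous_snd))
      have j2 : Integrable (fun x => ∫ y, sinLogCost δ (x - y) * (χ w T x * χ w T y)) volume :=
        (integrable_prod_of_continuous hc2).integral_prod_left
      calc ∫ x, ∫ y, (h x - h y) ^ 2 * (χ w T x * χ w T y)
          ≤ ∫ x, (A * χ w T x + 4 * H ^ 2 / Λ * ∫ y, sinLogCost δ (x - y) * (χ w T x * χ w T y)) :=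
            integral_mono (integrable_prod_of_continuous hc1).integral_prod_left
              (((hfc w).integrable_unitAddTorus.const_mul A).add (j2.const_mul _)) hin
        _ = A + 4 * H ^ 2 / Λ * ∫ x, ∫ y, sinLogCost δ (x - y) * (χ w T x * χ w T y) := by
            rw [integral_add ((hfc w).integrable_unitAddTorus.const_mul A) (j2.const_mul _), integral_const_mul,
              integral_const_mul, hf1, mul_one]
    nlinarith [hcost, hB0]
  -- integrate over `w`
  have hcL : Continuous (fun w : UnitAddTorus d => ∫ x, h x ^ 2 * χ w T x) :=
    (integral_integral_mul_reversedKernel_eq hκ hu hdiv hδ hδ4 hχ hχ0 hTI (Ψ := fun x => h x ^ 2)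
      (hhc.pow 2).measurable (fun x => sq_nonneg _) ((hhc.pow 2).integrable_unitAddTorus)).1
  have hmarg : ∫ w, ∫ x, h x ^ 2 * χ w T x = ∫ x, h x ^ 2 :=
    (integral_integral_mul_reversedKernel_eq hκ hu hdiv hδ hδ4 hχ hχ0 hTI (Ψ := fun x => h x ^ 2)
      (hhc.pow 2).measurable (fun x => sq_nonneg _) ((hhc.pow 2).integrable_unitAddTorus)).2
  have hcQ : Continuous (fun w : UnitAddTorus d => ∫ x, ∫ y, sinLogCost δ (x - y) * (χ w T x * χ w T y)) := by
    have h1 := continuous_pair_integral_reversedKernel hκ.le hδ hδ4 hχ hχ0 hTI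
      (K := fun x y => sinLogCost δ (x - y) * 1) ((hφc.comp (continuous_fst.sub continuous_snd)).mul continuous_const)
    refine h1.congr fun w => ?_
    rw [← integral_integral_pair_eq (sinLogCost δ) (fun x => χ w T x) (fun _ _ => (1 : ℝ))]
    simp
  have hcR : Continuous (fun w : UnitAddTorus d => ∫ x, ∫ y, h x * h y * (χ w T x * χ w T y)) := by
    have h1 := continuous_pair_integral_reversedKernel hκ.le hδ hδ4 hχ hχ0 hTI
      (K := fun x y => h x * h y) ((hhc.comp continuous_fst).mul (hhc.comp continuous_snd))
    refine h1.congr fun w => ?_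
    refine integral_congr_ae (Eventually.of_forall fun x => ?_)
    show χ w T x * ∫ y, χ w T y * (h x * h y) = ∫ y, h x * h y * (χ w T x * χ w T y)
    rw [← integral_const_mul]
    exact integral_congr_ae (Eventually.of_forall fun y => by ring)
  have iL : Integrable (fun w : UnitAddTorus d => (∫ x, h x ^ 2 * χ w T x) - (1 / 2) * (A + 4 * H ^ 2 / Λ *
      ∫ x, ∫ y, sinLogCost δ (x - y) * (χ w T x * χ w T y))) volume :=
    (hcL.sub (continuous_const.mul (continuous_const.add (continuous_const.mul hcQ)))).integrable_unitAddTorus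
  have hmono := integral_mono iL hcR.integrable_unitAddTorus hper
  have hval : ∫ w, ((∫ x, h x ^ 2 * χ w T x) - (1 / 2) * (A + 4 * H ^ 2 / Λ *
      ∫ x, ∫ y, sinLogCost δ (x - y) * (χ w T x * χ w T y))) =
      (∫ x, h x ^ 2) - (1 / 2) * (A + 4 * H ^ 2 / Λ *
        ∫ w, ∫ x, ∫ y, sinLogCost δ (x - y) * (χ w T x * χ w T y)) := by
    have i2 : Integrable (fun w : UnitAddTorus d => (1 / 2) * (A + 4 * H ^ 2 / Λ *
        ∫ x, ∫ y, sinLogCost δ (x - y) * (χ w T x * χ w T y))) volume :=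
      (continuous_const.mul (continuous_const.add (continuous_const.mul hcQ))).integrable_unitAddTorus
    have i5 : Integrable (fun _ : UnitAddTorus d => A) volume := integrable_const A
    have i6 : Integrable (fun w : UnitAddTorus d => 4 * H ^ 2 / Λ *
        ∫ x, ∫ y, sinLogCost δ (x - y) * (χ w T x * χ w T y)) volume := (continuous_const.mul hcQ).integrable_unitAddTorus
    have e7 : ∫ w : UnitAddTorus d, 4 * H ^ 2 / Λ * ∫ x, ∫ y, sinLogCost δ (x - y) * (χ w T x * χ w T y) =
        4 * H ^ 2 / Λ * ∫ w, ∫ x, ∫ y, sinLogCost δ (x - y) * (χ w T x * χ w T y) := integral_const_mul _ _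
    have e8 : ∫ _ : UnitAddTorus d, A = A := by rw [integral_const, probReal_univ, one_smul]
    rw [integral_sub hcL.integrable_unitAddTorus i2, hmarg, integral_const_mul, integral_add i5 i6, e7, e8]
  rw [hval] at hmono
  exact hmono

/-- **Young and duality**: `∫ (∫∫ h(x)h(y) χ^w(T,x)χ^w(T,y)) dw ≤ ‖θ(T)‖²_{L²}` for the classical
solution `θ` from `h` (`∫ h χ^w(T) = (θ(T) ⋆ k_δ)(w)` and `‖θ(T) ⋆ k_δ‖₂ ≤ ‖θ(T)‖₂`). [folklore] -/
theorem integral_pair_le_integral_sq (hT : 0 < T) (hδ : 0 < δ) (hδ4 : δ ≤ 1 / 4)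
    {χ : UnitAddTorus d → ℝ → UnitAddTorus d → ℝ}
    (hχ : ∀ w, IsClassicalScalarTransportOn (Icc 0 T) κ (fun τ x => -u (T - τ) x) (χ w))
    (hχ0 : ∀ w x, χ w 0 x = kernel δ (x - w)) (hθ : IsClassicalScalarTransportOn (Icc 0 T) κ u θ)
    (hθ0 : θ 0 = h) :
    ∫ w, ∫ x, ∫ y, h x * h y * (χ w T x * χ w T y) ≤ ∫ x, θ T x ^ 2 := by
  have hTI : T ∈ Icc 0 T := right_mem_Icc.2 hT.le
  have hθT : IsSmooth (θ T) := hθ.smooth_scalar.isSmooth_slice hTI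
  -- duality on the full window
  have hθ' : IsClassicalScalarTransportOn (Icc 0 T) κ (fun t x => u (t + (T - T)) x) θ := by
    have e : (fun t x => u (t + (T - T)) x) = u := by funext t x; simp
    rw [e]; exact hθ
  have hdual : ∀ w, ∫ x, θ T x * kernel δ (x - w) = ∫ x, h x * χ w T x := fun w =>
    reversedKernel_duality hχ hχ0 hT le_rfl hθ' hθ0 w
  have hconv : ∀ w, (θ T ⋆ kernel δ) w = ∫ x, h x * χ w T x := fun w => by
    rw [← hdual w, convolution_apply_eq]
    exact integral_congr_ae (Eventually.of_forall fun x => by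
      show θ T x * kernel δ (w - x) = θ T x * kernel δ (x - w)
      rw [← kernel_neg hδ hδ4 (x - w), neg_sub])
  have hsq : ∀ w, ∫ x, ∫ y, h x * h y * (χ w T x * χ w T y) = ((θ T ⋆ kernel δ) w) ^ 2 := fun w => by
    rw [hconv w, sq_integral_mul_eq]
  simp_rw [hsq]
  have h1 := sqrt_integral_sq_convolution_kernel_le (hθT.memLp 2) hδ hδ4
  exact (Real.sqrt_le_sqrt_iff (integral_nonneg fun x => sq_nonneg _)).1 h1

/-- **The core inequality of the logarithmic dissipation bound for releases** (smooth drift,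
every scale `ℓ > 0`). [folklore] -/
theorem two_mul_scalarDissipation_le_core (hκ : 0 < κ) (hT : 0 < T)
    (hθ : IsClassicalScalarTransportOn (Icc 0 T) κ u θ) (hθ0 : θ 0 = h) (hh : IsSmooth h)
    {H L ℓ S : ℝ} (hH : ∀ x, |h x| ≤ H) (hL : ∀ x, ‖Torus.gradient h x‖ ≤ L) (hℓ : 0 < ℓ)
    (hδ : 0 < δ) (hδ4 : δ ≤ 1 / 4) (hκδ : κ = δ ^ 2) (hS0 : 0 ≤ S)
    (hS : ∫⁻ t in Ioo 0 T, eGradNormSq (u t) ^ (1 / 2 : ℝ) ≤ ENNReal.ofReal S) :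
    2 * scalarDissipation κ θ 0 T ≤ (1 / 2) * (Fintype.card d * L ^ 2 * ℓ ^ 2 +
      4 * H ^ 2 / Real.log (1 + 4 * ℓ ^ 2 / δ ^ 2) *
        (Real.log (1 + 4 * π ^ 2 * Fintype.card d) + 4 * π ^ 2 * Fintype.card d * T +
          2 * π * Real.sqrt ((twoPointL2Const d).toReal * Fintype.card d) * S)) := by
  have hu := hθ.smooth_velocity
  have hdiv := hθ.divFree
  obtain ⟨χ, hχ, hχ0⟩ := exists_reversedKernelFamily hκ hT hu hdiv hδ hδ4
  have hΛ : 0 < Real.log (1 + 4 * ℓ ^ 2 / δ ^ 2) := Real.log_pos (lt_add_of_pos_right 1 (by positivity))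
  have hB0 : 0 ≤ 4 * H ^ 2 / Real.log (1 + 4 * ℓ ^ 2 / δ ^ 2) := by positivity
  -- the separation functional
  have hQ := integral_pairT_reversedKernel_le hκ hT hu hdiv hδ hδ4 hχ hχ0 hδ hκδ hS0 hS
  have hQ0 : ∫ w : UnitAddTorus d, ∫ x, ∫ y, sinLogCost δ (x - y) * (kernel δ (x - w) * kernel δ (y - w)) ≤
      Real.log (1 + 4 * π ^ 2 * Fintype.card d) := by
    have hpt : ∀ w : UnitAddTorus d, ∫ x, ∫ y, sinLogCost δ (x - y) * (kernel δ (x - w) * kernel δ (y - w)) ≤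
        Real.log (1 + 4 * π ^ 2 * Fintype.card d) := fun w => by
      have := integral_integral_sinLogCost_kernel_le hδ hδ4 δ w
      rwa [mul_div_assoc, div_self (pow_ne_zero 2 hδ.ne'), mul_one] at this
    have hnn : ∀ w : UnitAddTorus d, 0 ≤ ∫ x, ∫ y, sinLogCost δ (x - y) * (kernel δ (x - w) * kernel δ (y - w)) :=
      fun w => integral_nonneg fun x => integral_nonneg fun y =>
        mul_nonneg (sinLogCost_nonneg δ _) (mul_nonneg (kernel_nonneg hδ.le _) (kernel_nonneg hδ.le _))
    calc ∫ w : UnitAddTorus d, ∫ x, ∫ y, sinLogCost δ (x - y) * (kernel δ (x - w) * kernel δ (y - w))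
        ≤ ∫ _ : UnitAddTorus d, Real.log (1 + 4 * π ^ 2 * Fintype.card d) :=
          integral_mono_of_nonneg (Eventually.of_forall hnn) (integrable_const _) (Eventually.of_forall hpt)
      _ = Real.log (1 + 4 * π ^ 2 * Fintype.card d) := by rw [integral_const, probReal_univ, one_smul]
  -- the datum side and the energy identity
  have hvar := integral_sq_sub_le_integral_pair hκ hT hu hdiv hδ hδ4 hχ hχ0 hh hH hL hℓ
  have hyoung := integral_pair_le_integral_sq hT hδ hδ4 hχ hχ0 hθ hθ0
  have henergy := IsClassicalScalarTransportOn.scalarL2Sq_add_scalarDissipation_holds hθ hT.le subset_rfl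
  rw [hθ0] at henergy
  simp only [scalarL2Sq] at henergy
  -- combine
  have hmonoQ : 4 * H ^ 2 / Real.log (1 + 4 * ℓ ^ 2 / δ ^ 2) *
      ∫ w, ∫ x, ∫ y, sinLogCost δ (x - y) * (χ w T x * χ w T y) ≤
      4 * H ^ 2 / Real.log (1 + 4 * ℓ ^ 2 / δ ^ 2) *
        (Real.log (1 + 4 * π ^ 2 * Fintype.card d) + 4 * π ^ 2 * Fintype.card d * T +
          2 * π * Real.sqrt ((twoPointL2Const d).toReal * Fintype.card d) * S) :=
    mul_le_mul_of_nonneg_left (hQ.trans (by linarith)) hB0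
  linarith


end Core

section Main

variable {κ T : ℝ} {u : ℝ → UnitAddTorus d → EuclideanSpace ℝ d} {θ : ℝ → UnitAddTorus d → ℝ}

/-! ## The dissipation functional of a classical solution -/

omit [DecidableEq d] in
/-- For a classical solution on `[0,T]`, the spectral dissipation `eScalarDissipation κ θ 0 T`
is `ofReal` of the classical one `κ ∫₀ᵀ ∫ ‖∇θ‖²` (`κ ≥ 0`). [folklore] -/
theorem eScalarDissipation_eq_ofReal [DecidableEq d] (hκ : 0 ≤ κ) (hT : 0 < T)
    (hθ : IsClassicalScalarTransportOn (Icc 0 T) κ u θ) :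
    eScalarDissipation κ θ 0 T = ENNReal.ofReal (scalarDissipation κ θ 0 T) := by
  have hGc : ContinuousOn (fun t => scalarGradNormSq (θ t)) (Icc 0 T) :=
    hθ.continuousOn_scalarGradNormSq (convex_Icc 0 T) (uniqueDiffOn_Icc hT)
  have hGi : IntegrableOn (fun t => scalarGradNormSq (θ t)) (Ioo 0 T) :=
    hGc.integrableOn_Icc.mono_set Ioo_subset_Icc_self
  have h1 : ∫⁻ t in Ioo 0 T, eScalarGradNormSq (θ t) = ENNReal.ofReal (∫ t in Ioo 0 T, scalarGradNormSq (θ t)) := by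
    rw [ofReal_integral_eq_lintegral_ofReal hGi (Eventually.of_forall fun t => scalarGradNormSq_nonneg _)]
    refine setLIntegral_congr_fun measurableSet_Ioo fun t ht => ?_
    exact eScalarGradNormSq_eq_ofReal_integral (hθ.smooth_scalar.isSmooth_slice (Ioo_subset_Icc_self ht))
  rw [eScalarDissipation, h1, ← ENNReal.ofReal_mul hκ, scalarDissipation, intervalIntegral.integral_of_le hT.le,
    integral_Ioc_eq_integral_Ioo]

/-! ## The smooth-drift theorem -/

/-- `log(1/κ) ≤ 2/√κ` for `κ > 0`. [folklore] -/
theorem log_inv_le_two_div_sqrt {κ : ℝ} (hκ : 0 < κ) : Real.log κ⁻¹ ≤ 2 / Real.sqrt κ := by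
  have hs : 0 < Real.sqrt κ := Real.sqrt_pos.2 hκ
  have h1 : Real.log κ⁻¹ = 2 * Real.log (Real.sqrt κ)⁻¹ := by
    rw [Real.log_inv, Real.log_inv, Real.log_sqrt hκ.le]; ring
  have h2 : Real.log (Real.sqrt κ)⁻¹ ≤ (Real.sqrt κ)⁻¹ - 1 := Real.log_le_sub_one_of_pos (inv_pos.2 hs)
  rw [h1, div_eq_mul_inv]
  have : 0 ≤ (Real.sqrt κ)⁻¹ := inv_nonneg.2 hs.le
  linarith

/-- `½ log(1/κ) ≤ log(1 + 1/√κ)` for `κ > 0`. [folklore] -/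
theorem half_log_inv_le {κ : ℝ} (hκ : 0 < κ) : Real.log κ⁻¹ / 2 ≤ Real.log (1 + 1 / Real.sqrt κ) := by
  have hs : 0 < Real.sqrt κ := Real.sqrt_pos.2 hκ
  have h1 : Real.log κ⁻¹ / 2 = Real.log (Real.sqrt κ)⁻¹ := by
    rw [Real.log_inv, Real.log_inv, Real.log_sqrt hκ.le]; ring
  rw [h1]
  refine Real.log_le_log (inv_pos.2 hs) ?_
  rw [one_div]; linarith

/-- **The logarithmic dissipation bound for releases, smooth drifts** (two-point form of the
Crippa–De Lellis / Seis logarithmic estimate, at Sobolev level `∫‖∇u‖_{L²} dt ≤ S`): for every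
dimension and datum bounds `|h| ≤ H`, `‖∇h‖ ≤ L` and every maximal window `T₀` there are
`κ₀ ∈ (0,1)` and `C ≥ 0` such that for `κ ≤ κ₀`, `T ≤ T₀`, every smooth divergence-free drift on
`[0,T] × T^d` with `∫₀ᵀ ‖∇u‖_{L²} ≤ S` and the classical solution `θ` of `∂ₜθ + u·∇θ = κΔθ`,
`θ(0) = h`: `κ∫₀ᵀ‖∇θ‖² ≤ C (S + 1)/log(1/κ)`. [folklore] -/
theorem releaseLogBound_smooth (H L T₀ : ℝ) (hT₀ : 0 < T₀) :
    ∃ κ₀ C : ℝ, 0 < κ₀ ∧ κ₀ < 1 ∧ 0 ≤ C ∧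
      ∀ (κ T S : ℝ) (u : ℝ → UnitAddTorus d → EuclideanSpace ℝ d) (h : UnitAddTorus d → ℝ)
        (θ : ℝ → UnitAddTorus d → ℝ),
        0 < κ → κ ≤ κ₀ → 0 < T → T ≤ T₀ → 0 ≤ S →
        ∫⁻ t in Ioo 0 T, eGradNormSq (u t) ^ (1 / 2 : ℝ) ≤ ENNReal.ofReal S →
        IsSmooth h → (∀ x, |h x| ≤ H) → (∀ x, ‖Torus.gradient h x‖ ≤ L) →
        IsClassicalScalarTransportOn (Icc 0 T) κ u θ → θ 0 = h →
        eScalarDissipation κ θ 0 T ≤ ENNReal.ofReal (C * (S + 1) / Real.log κ⁻¹) := by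
  set n : ℝ := (Fintype.card d : ℝ) with hn
  set q₀ : ℝ := Real.log (1 + 4 * π ^ 2 * n) with hq₀
  set cC : ℝ := Real.sqrt ((twoPointL2Const d).toReal * n) with hcC
  have hn0 : 0 ≤ n := Nat.cast_nonneg _
  have hq₀0 : 0 ≤ q₀ := Real.log_nonneg (by nlinarith [Real.pi_pos, sq_nonneg π])
  have hcC0 : 0 ≤ cC := Real.sqrt_nonneg _
  set C : ℝ := n * L ^ 2 / 8 + 2 * H ^ 2 * (q₀ + 4 * π ^ 2 * n * T₀) + 4 * π * H ^ 2 * cC with hC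
  refine ⟨1 / 16, C, by norm_num, by norm_num, by positivity, ?_⟩
  intro κ T S u h θ hκ hκ0 hT hTT₀ hS0 hS hh hH hL hθ hθ0
  -- scales
  set δ : ℝ := Real.sqrt κ with hδdef
  have hδ : 0 < δ := Real.sqrt_pos.2 hκ
  have hκδ : κ = δ ^ 2 := (Real.sq_sqrt hκ.le).symm
  have hδ4 : δ ≤ 1 / 4 := by
    rw [hδdef, show (1 / 4 : ℝ) = Real.sqrt (1 / 16) by
      rw [show (1 / 16 : ℝ) = (1 / 4) ^ 2 by norm_num, Real.sqrt_sq (by norm_num)]]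
    exact Real.sqrt_le_sqrt hκ0
  set ℓ : ℝ := Real.sqrt δ / 2 with hℓdef
  have hℓ : 0 < ℓ := by positivity
  have hℓ2 : ℓ ^ 2 = δ / 4 := by rw [hℓdef, div_pow, Real.sq_sqrt hδ.le]; norm_num
  have hℓδ : 4 * ℓ ^ 2 / δ ^ 2 = 1 / δ := by rw [hℓ2]; field_simp
  set Lg : ℝ := Real.log κ⁻¹ with hLg
  have hκ1 : κ < 1 := hκ0.trans_lt (by norm_num)
  have hLg0 : 0 < Lg := Real.log_pos ((one_lt_inv₀ hκ).2 hκ1)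
  have hH0 : 0 ≤ H := (abs_nonneg _).trans (hH 0)
  -- the core inequality at scale `ℓ`
  have hcore := two_mul_scalarDissipation_le_core hκ hT hθ hθ0 hh hH hL hℓ hδ hδ4 hκδ hS0 hS
  rw [hℓδ] at hcore
  set Λ : ℝ := Real.log (1 + 1 / δ) with hΛ
  have hΛLg : Lg / 2 ≤ Λ := half_log_inv_le hκ
  have hΛ0 : 0 < Λ := by linarith
  set X : ℝ := q₀ + 4 * π ^ 2 * n * T + 2 * π * cC * S with hX
  set X₀ : ℝ := q₀ + 4 * π ^ 2 * n * T₀ + 2 * π * cC * S with hX₀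
  have hX0 : 0 ≤ X := by positivity
  have hXX₀ : X ≤ X₀ := by
    have : 4 * π ^ 2 * n * T ≤ 4 * π ^ 2 * n * T₀ := mul_le_mul_of_nonneg_left hTT₀ (by positivity)
    linarith
  -- `(4H²/Λ) X Lg ≤ 8 H² X₀`
  have hBX : 4 * H ^ 2 / Λ * X * Lg ≤ 8 * H ^ 2 * X₀ := by
    have h1 : 4 * H ^ 2 / Λ * X * Lg ≤ 4 * H ^ 2 / Λ * X * (2 * Λ) :=
      mul_le_mul_of_nonneg_left (by linarith) (by positivity)
    have h2 : 4 * H ^ 2 / Λ * X * (2 * Λ) = 8 * H ^ 2 * X := by field_simp; ring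
    have h3 : 8 * H ^ 2 * X ≤ 8 * H ^ 2 * X₀ := mul_le_mul_of_nonneg_left hXX₀ (by positivity)
    linarith
  -- `n L² ℓ² Lg ≤ n L² / 2`
  have hAℓ : n * L ^ 2 * ℓ ^ 2 * Lg ≤ n * L ^ 2 / 2 := by
    have h1 : δ * Lg ≤ 2 := by
      have := log_inv_le_two_div_sqrt hκ
      rw [← hδdef] at this
      have h := mul_le_mul_of_nonneg_left this hδ.le
      rwa [mul_div_cancel₀ _ hδ.ne'] at h
    rw [hℓ2]
    have : 0 ≤ n * L ^ 2 := by positivity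
    nlinarith
  -- hence `scalarDissipation · Lg ≤ C (S + 1)`
  have hsd : scalarDissipation κ θ 0 T * Lg ≤ C * (S + 1) := by
    have h1 : 2 * scalarDissipation κ θ 0 T * Lg ≤ (1 / 2) * (n * L ^ 2 * ℓ ^ 2 + 4 * H ^ 2 / Λ * X) * Lg :=
      mul_le_mul_of_nonneg_right hcore hLg0.le
    have h2 : (1 / 2) * (n * L ^ 2 * ℓ ^ 2 + 4 * H ^ 2 / Λ * X) * Lg ≤ n * L ^ 2 / 4 + 4 * H ^ 2 * X₀ := by
      have e : (1 / 2) * (n * L ^ 2 * ℓ ^ 2 + 4 * H ^ 2 / Λ * X) * Lg =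
          (1 / 2) * (n * L ^ 2 * ℓ ^ 2 * Lg) + (1 / 2) * (4 * H ^ 2 / Λ * X * Lg) := by ring
      rw [e]; linarith
    have h3 : n * L ^ 2 / 8 + 2 * H ^ 2 * X₀ ≤ C * (S + 1) := by
      have e : C * (S + 1) - (n * L ^ 2 / 8 + 2 * H ^ 2 * X₀) =
          (n * L ^ 2 / 8 + 2 * H ^ 2 * (q₀ + 4 * π ^ 2 * n * T₀)) * S + 4 * π * H ^ 2 * cC := by
        rw [hC, hX₀]; ring
      have : 0 ≤ (n * L ^ 2 / 8 + 2 * H ^ 2 * (q₀ + 4 * π ^ 2 * n * T₀)) * S + 4 * π * H ^ 2 * cC := by positivity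
      linarith
    linarith
  have hsd' : scalarDissipation κ θ 0 T ≤ C * (S + 1) / Lg := by
    rw [le_div_iff₀ hLg0]; exact hsd
  rw [eScalarDissipation_eq_ofReal hκ.le hT hθ]
  exact ENNReal.ofReal_le_ofReal hsd'

end Main

end Torus

end Literature.Analysis.FluidPDE
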